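import Summits.QuantumFields.YangMills.Theorems.BalabanUVNodesN05SubBHKnit

/-!
# BalabanUVNodes ∕ N05 ([Balaban1985RegularSpaces] Lemma 1 – Thm 8): THE N05 KNIT AT THE REPAIRED SLOT `Node00.B8LeafOfRecordSubBH`, RE-KEYED TO THE
# `Ω₀ = ℤᵈ` LAW MEMBERS — the letters ∕ b9 sockets of `BalabanUVNodesN05SubBHKnit` (p514768) demanded ONLY on the sub-index of record (the consumers' index), the
# certified-unsatisfiable cube sockets DROPPED (Proposition 6 displayed), everything else BY NAME

Track A of `YM-PLAN.md` (cell `pub-ymgap`, HUMAN RULING D-0062), node **N05**; seat `pub-ymgap-dag-n05-d` (g6), 2026-08-27.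

WHY (located, kernel facts).  Every N05 knit of this lineage since `BalabanUVNodesN05SubBKnit` (p467769 … p514768 ∕ p515416) keys [4]'s letters and the b9 socket as
`∀ i : ZdIdx d L, IdxB8LawsB L i → …` — ALL law members — while consuming them only at `ι := (·.1.1) : IdxB8SubB θ → ZdIdx` (members with `Ω 0 = ℤᵈ`).  The law class
CONTAINS Proposition 6's finite-`□₀` cube family (`B8IdxB8LawsB.exists_member_cube_lawsB`: `i.Ω = cubeFam false …`, `i.Λs = cubeLamS …`, `i.Λb = cubeLamB …`, `IdxB8LawsB L
i`), at which the all-levels (1.59) socket is FALSE by the corner defect (`B8JunctionH59Vacuity.not_sockB9P3_allLevels_cubeMember`, dag-n05-e g5; `CORNER-DEFECT-H59.md`):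
so the `SB9all` binder of those knits is unsatisfiable by ONE instantiation, and their cube sockets `SLetC ∕ SB9C` are certified unsatisfiable as a family
(`B8SockB9P3CubeBinderVacuity.not_sockB9P3_cubeBinder`, p508450; dag-ref-E READ-12).  THIS FILE is the repair at the knit level (print's own choice, p. 77 «we admit
Ω_j = T_η»; (R-b′) of `CORNER-DEFECT-H59.md`): the three member sockets are demanded at `i.Ω 0 = ℤᵈ ∧ IdxB8LawsB` ONLY (no kernel refutation applies there; their
satisfiability = [Balaban1985BackgroundPropagators] Thms 3.1 ∕ 3.3 at Bałaban's operators, the N06 lineage's theorem — NOT claimed), the cube sockets are GONE and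
Proposition 6 is a DISPLAYED printed member again (as in p482401) until the cube line is re-typed at `cubeFam true`.

WHAT IS PROVED (composition BY NAME; no estimate; no new definition):
* `b8LeafOfRecordSubBH_cutSubB_of_knit_lettersRDUB_univ_t8H` — for any Prop-5 family `lan` with `p5e ∕ p5u` given: the repaired slot at `λ.cutSubB J lan c₁` from the
  `Ω₀ = ℤᵈ`-member sockets + `p6 p7 t8H`;
* ★ `b8LeafOfRecordSubBH_cutSubB_zdLan_of_knit_lettersRDUB_univ_t8H` — Prop. 5 ∃∕! DISCHARGED at `zdLan ∘ ι` from [4]'s letters at the Prop-5 members (`SLetL ∕ SLetLU`).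
DISPLAYED after this file: `p6` (Prop. 6 p. 99), `p7` (Prop. 7 p. 100), `t8H` (Thm 8 p. 101 at the repaired members — knit in from its sourced sockets by the sequel
`BalabanUVNodesN05SubBHKnitUnivT8Srv`), and [4]-type sockets at `Ω₀ = ℤᵈ` members only.
HONEST FRAMING: kernel bookkeeping by name; all sockets are HYPOTHESES; `p6 ∕ p7 ∕ t8H` are HYPOTHESES = N05's own printed members NOT discharged here; count-neutral; **N05 NOT
discharged**; Bałaban AS PRINTED with locators; one finite 𝕋⁴ programme at fixed ε; nothing continuum ∕ ℝ⁴ ∕ OS ∕ mass-gap ∕ Clay.  No `sorry`, no new definition.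
[cite: Balaban1985RegularSpaces, Lemma 1 p.79, Thm 2 p.83, Prop. 3 p.87, Thm 4 p.88, Prop. 5 (1.106)–(1.109) p.94, Prop. 6 (1.131)–(1.133) p.99, Prop. 7 p.100, Thm 8 (1.146) p.101, p.77; Balaban1985BackgroundPropagators, Thm 3.1 p.397, Thm 3.3 p.398, (3.25) p.394]
-/

noncomputable section

namespace Summit.QuantumFields.YangMills.BalabanUVNodes.N05SubBHKnitUniv

open Literature.MathematicalPhysics.QuantumFieldTheory.Balaban1983to89
open Literature.MathematicalPhysics.QuantumFieldTheory.Balaban1983to89.Node00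
open Literature.MathematicalPhysics.QuantumFieldTheory.Balaban1983to89.B8IdxB8LawsB (towerBonds IdxB8LawsB IdxB8SubB famB8OfRecordSubB)
open Literature.MathematicalPhysics.QuantumFieldTheory.Balaban1983to89.B8LeafModelZd (ZdIdx)
open Literature.MathematicalPhysics.QuantumFieldTheory.Balaban1983to89.B8LeafModelZd3 (SockB9P3)
open Literature.MathematicalPhysics.QuantumFieldTheory.Balaban1983to89.B8SockLettersRD (SockLettersRD)
open Literature.MathematicalPhysics.QuantumFieldTheory.Balaban1983to89.B8LeafKnitRS (B8LeafRS)
open Literature.MathematicalPhysics.QuantumFieldTheory.Balaban1983to89.B8Lemma1NonAbelian (blockPairNA)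
open Literature.MathematicalPhysics.QuantumFieldTheory.Balaban1983to89.B8Eq131CubesAdmissible (cubeFam)
open Literature.MathematicalPhysics.QuantumFieldTheory.Balaban1983to89.B8CubeMemberZd (cubeLamS cubeLamB)
open Literature.MathematicalPhysics.QuantumFieldTheory.Balaban1983to89.B8SockHFPCubeMemberRD (sockHFP_pair_cubeMemberRD)
open Literature.MathematicalPhysics.QuantumFieldTheory.Balaban1983to89.B8Prop6CubeMemberGauged (prop6Printed_zdCub₃)
open Literature.MathematicalPhysics.QuantumFieldTheory.Balaban1983to89.B8LeafSocketsB9 (sockH59_of_allLevels)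
open Literature.MathematicalPhysics.QuantumFieldTheory.Balaban1983to89.B8Prop5LandauDataZd (ZdLanIdx zdLan)
open Literature.MathematicalPhysics.QuantumFieldTheory.Balaban1983to89.B8Prop5ExistsZdLan (prop5Exists_zdLan_of_lettersRD)
open Literature.MathematicalPhysics.QuantumFieldTheory.Balaban1983to89.B8Prop5UniqueZdLan (prop5Unique_zdLan_of_lettersUB)
open Literature.MathematicalPhysics.QuantumFieldTheory.Balaban1983to89.B8LeafKnitZd3FourPrinted (fourPrinted_zd3_map_lettersRDUB)
open B7Prop1Explicit B7Prop2Explicit B7Prop1Local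
open B8Ineq130 (tlo thi)
open B8Ineq132 (InAk covDerivFwd)
open B7Eq78Linearization (zdBlocking QprimeIter)
open B8Eq119TwistedAxial (bgT)
open B8Eq140Level (SideTouches)
open B8Eq138LandauZd (covLap QT)
open B8Eq1117Concrete (XSpace)
open B8Prop5ContractionKLevel (Bd2)
open B8LambdaSpaceKLevel (wt)

-- `Site` alone could resolve to the torus sites of `Setup.lean`; re-export the `ℤ^d` sites of `B7Prop1Explicit`.
export B7Prop1Explicit (Site)

section KnitUniv

/-- **THE N05 KNIT AT THE REPAIRED SLOT, SOCKETS AT THE `Ω₀ = ℤᵈ` LAW MEMBERS ONLY** — from [4]'s letters on print's domains (`SLet`, `SLetUB`) and the b9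
socket (`SB9all`) AT THE MEMBERS OF THE SUB-INDEX OF RECORD (`i.Ω 0 = ℤᵈ ∧ IdxB8LawsB`, the only members any consumer reads), Proposition 5 ∃∕! at an arbitrary family
`lan`, Proposition 6 on the record's cube family at `c₁`, Proposition 7, and Theorem 8 surviving at the repaired members, the REPAIRED slot holds at the cut layer:
`B8LeafOfRecordSubBH θ (λ.cutSubB J lan c₁)`.  `BalabanUVNodesN05SubBHKnit.exists_c₁_b8LeafOfRecordSubBH_cutSubB_of_knit_lettersRDUB_t8H` (p514768) RE-KEYED: its `SLet ∕
SLetUB ∕ SB9all` binders ranged over ALL law members of `ZdIdx` — a class that CONTAINS Proposition 6's finite-`□₀` cube members (`B8IdxB8LawsB.exists_member_cube_lawsB`), at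
which the all-levels (1.59) socket is certified FALSE (`B8JunctionH59Vacuity.not_sockB9P3_allLevels_cubeMember`, the corner defect) — so that binder set was UNSATISFIABLE; and
its cube sockets `SLetC ∕ SB9C` (feeding Prop. 6 through `prop6Printed_zdCub₃`) are certified unsatisfiable outright (`B8SockB9P3CubeBinderVacuity.not_sockB9P3_cubeBinder`,
p508450).  Here the sockets are demanded at `Ω₀ = ℤᵈ` members only (print p. 77 «we admit Ω_j = T_η»; no kernel refutation applies — satisfiability is the [4]-providers'
theorem, not claimed) and Proposition 6 is DISPLAYED again (its cube road awaits the cube line's re-typing at print's `Ω₀ = T`, dag-n05-e `CORNER-DEFECT-H59.md` (R-b′)).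
Proof: `fourPrinted_zd3_map_lettersRDUB` at `ι := (·.1.1)` + the reading `b8LeafOfRecordSubBH_cutSubB_iff_subB_and_t8H`.
[cite: Balaban1985RegularSpaces, Lemma 1 p.79, Thm 2 p.83, Prop. 3 p.87, Thm 4 p.88, Prop. 5 p.94, Prop. 6 (1.131)–(1.133) p.99, Prop. 7 p.100, Thm 8 (1.146) p.101, p.77 («Ω_j = T_η»); Balaban1985BackgroundPropagators, Thm 3.1 p.397, Thm 3.3 p.398] -/
theorem b8LeafOfRecordSubBH_cutSubB_of_knit_lettersRDUB_univ_t8H {θ : Stage3Params} (lam : ResidB8 θ) (hD : 2 ≤ θ.D) (hB₁' : lam.B₁' = 5 * (θ.D : ℝ) * θ.L * lam.inp.B₀)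
   
    {cB9 B₀'H B₂' BG BR cL : ℝ} (hB : 2 ≤ 5 * (θ.D : ℝ) * θ.L * lam.inp.B₀) (hB₀β : 0 < lam.B₀β) (hC₂ : 2097152 * ((θ.D : ℝ) + 1) ^ 2 ≤ lam.C₂)
    (hcB9 : 0 < cB9) (hB₀'H : 0 < B₀'H) (hB₂' : 0 ≤ B₂') (hBG : 0 ≤ BG) (hBR : 0 ≤ BR) (hcL : 0 < cL)
    (hfree : 3 * (2 * (θ.D : ℝ) * (θ.L : ℝ) ^ 2) * BG * BR ≤ lam.inp.B₀')
    -- [4]'s letters and the b9 socket AT THE `Ω₀ = ℤᵈ` LAW MEMBERS ONLY (= the sub-index of record `IdxB8SubB θ`; the cube members are EXCLUDED): existence side (laws on print's domains) and uniqueness side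
    (SLet : ∀ i : ZdIdx θ.D θ.L, i.Ω 0 = Set.univ → IdxB8LawsB θ.L i → SockLettersRD (𝔸 := θ.𝔸) θ.L BG BR B₀'H B₂' cL i.η i.k i.Ω i.Λs)
    (SLetUB : ∀ i : ZdIdx θ.D θ.L, i.Ω 0 = Set.univ → IdxB8LawsB θ.L i → ∀ α₀ : ℝ, 0 < α₀ → α₀ ≤ cL → ∀ U₀ : Site θ.D → Fin θ.D → θ.𝔸ˣ, (∀ x κ, U₀ x κ ∈ unitaryUnits θ.𝔸) →
      InAk θ.L i.k i.η α₀ i.Ω U₀ →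
      ∃ (g Δ : (Site θ.D → θ.𝔸) →ₗ[ℂ] (Site θ.D → θ.𝔸)) (q : (Site θ.D → θ.𝔸) →ₗ[ℂ] (ℕ → Site θ.D → θ.𝔸))
        (qs : (ℕ → Site θ.D → θ.𝔸) →ₗ[ℂ] (Site θ.D → θ.𝔸)) (Aw c : (ℕ → Site θ.D → θ.𝔸) →ₗ[ℂ] (ℕ → Site θ.D → θ.𝔸))
        (H' : XSpace θ.D i.k θ.𝔸 →ₗ[ℂ] (Site θ.D → θ.𝔸)),
        (∀ x : Site θ.D → θ.𝔸, (∃ C : ℝ, ∀ y, ‖x y‖ ≤ C) → g (Δ x + qs (Aw (q x))) = x) ∧ (∀ φ, qs (c (q (g (g (qs φ))))) = qs φ) ∧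
        (∀ (f : Site θ.D → θ.𝔸), ∀ x ∈ i.Ω 0, Δ f x = covLap i.η U₀ ((i.Ω 0).indicator f) x) ∧
        (∀ (μ : ℕ → Site θ.D → θ.𝔸), ∀ x ∈ i.Ω 0, qs μ x = QT θ.L i.k (i.Λs i.k) U₀ μ x) ∧
        (∀ (f : Site θ.D → θ.𝔸) (n : ℕ), n ≤ i.k → ∀ y ∈ i.Λs i.k n, q f n y = QprimeIter (zdBlocking θ.D θ.L) (bgT θ.L U₀) n f y) ∧
        (∀ (f : Site θ.D → θ.𝔸) (n : ℕ) (y : Site θ.D), ¬ (n ≤ i.k ∧ y ∈ i.Λs i.k n) → q f n y = 0) ∧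
        (∀ (X : XSpace θ.D i.k θ.𝔸) (x : Site θ.D), ‖H' X x‖ ≤ B₀'H * ‖X‖) ∧
        (∀ n, n ≤ i.k → ∀ (X : XSpace θ.D i.k θ.𝔸), ∀ p ∈ {b : Site θ.D × Fin θ.D | SideTouches (i.Ω n) b.1 b.2},
          wt θ.L i.η n * ‖covDerivFwd i.η U₀ p.2 (H' X) p.1‖ ≤ B₀'H * ‖X‖) ∧
        (∀ X : XSpace θ.D i.k θ.𝔸, Bd2 θ.L i.η i.k i.Ω (covLap i.η U₀ (H' X)) (B₂' * ‖X‖)) ∧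
        (∀ (Y : XSpace θ.D i.k θ.𝔸) (n : ℕ) (hn : n ≤ i.k) (y : Site θ.D), y ∈ i.Λs i.k n →
          QprimeIter (zdBlocking θ.D θ.L) (bgT θ.L U₀) n (H' Y) y = Y (⟨n, Nat.lt_succ_of_le hn⟩, y)) ∧
        (∀ (f : Site θ.D → θ.𝔸) (r : ℝ), 0 ≤ r → Bd2 θ.L i.η i.k i.Ω f r →
          (∀ x, ‖g f x‖ ≤ BG * r) ∧ ∀ n, n ≤ i.k → ∀ p ∈ {b : Site θ.D × Fin θ.D | SideTouches (i.Ω n) b.1 b.2},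
            wt θ.L i.η n * ‖covDerivFwd i.η U₀ p.2 (g f) p.1‖ ≤ BG * r) ∧
        (∀ (f : Site θ.D → θ.𝔸) (r : ℝ), 0 ≤ r → Bd2 θ.L i.η i.k i.Ω f r → Bd2 θ.L i.η i.k i.Ω (f - g (qs (c (q (g f))))) (BR * r)))
    (SB9all : ∀ i : ZdIdx θ.D θ.L, i.Ω 0 = Set.univ → IdxB8LawsB θ.L i → ∀ m, m ≤ i.k →
      SockB9P3 (𝔸 := θ.𝔸) θ.L lam.inp.B₀ lam.B₀β cB9 lam.β lam.len i.η m i.Ω i.Λs i.Λb)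
    -- the remaining printed members over the bond-law sub-index (hypotheses): PROPOSITION 5 at an arbitrary family `lan`, PROPOSITION 6, PROPOSITION 7, THEOREM 8 SURVIVING AT THE REPAIRED MEMBERS
    {J : Type} {lan : J → B8.LandauData}
    (p5e : B8.Prop5Exists lam.inp.B₀' lam.B₁ lan) (p5u : B8.Prop5Unique lan)
    -- PROPOSITION 6 on the record's cube family at the cut constant `c₁` (DISPLAYED: its cube-socket road `SLetC`∕`SB9C` is certified unsatisfiable, p508450)
    (c₁ : ℝ) (p6 : B8.Prop6Printed θ.D (θ.L : ℝ) lam.B₁ c₁ (fun j : IdxB8SubB θ => cubB8OfRecord θ j.1))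
    (p7 : B8SectGH.Prop7PrintedR (fun j : IdxB8SubB θ => famB8OfRecordSubB θ lam.β lam.len j) (fun j => lam.toAxial j.1))
    (t8H : B8Thm8Surviving.Thm8SurvivingAt 1 lam.B₁ lam.B₂ (fun j : IdxB8SubB θ => famB8OfRecordSubBH θ lam.β lam.len j)) :
    B8LeafOfRecordSubBH θ (lam.cutSubB J lan c₁) := by
  -- Lemma 1, Theorem 2, Proposition 3, Theorem 4 at the `Ω₀ = ℤᵈ` law members, t8-free (this seat's `fourPrinted_zd3_map_lettersRDUB` at `ι := (·.1.1)`)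
  obtain ⟨l1, t2, p3, t4⟩ := fourPrinted_zd3_map_lettersRDUB (𝔸 := θ.𝔸) hD θ.two_le_L θ.L lam.β lam.len lam.inp hB hB₀β hC₂ hcB9 hB₀'H hB₂' hBG
    hBR hcL hfree (fun j : IdxB8SubB θ => j.1.1) (fun j => j.1.2) (fun j => IdxB8SubB.tower_all j) (fun j => j.2.trunc_lt) (fun j => j.2.trunc_top)
    (fun j => SLet j.1.1 j.1.2 j.2) (fun j => SLetUB j.1.1 j.1.2 j.2) (fun j => SB9all j.1.1 j.1.2 j.2)
  refine (b8LeafOfRecordSubBH_cutSubB_iff_subB_and_t8H lam J lan c₁).2 ⟨⟨l1, t2, p3, ?_, p5e, p5u, p6, p7⟩, t8H⟩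
  rw [hB₁']
  exact t4

/-- **THE SAME WITH PROPOSITION 5 ∃∕! DISCHARGED AT PRINT's `zdLan` FAMILY** — the repaired slot at the cut layer whose Proposition-5 index is `zdLan θ.L λ.B₁ ∘ ι` for any
map `ι` into `Ω 0 = ℤᵈ` members with antitone regions and towers inside `Ω_j`, given [4]'s letters at each (`SLetL`, `SLetLU`): Prop. 5 ∃ by `prop5Exists_zdLan_of_lettersRD`,
Prop. 5 ! by `prop5Unique_zdLan_of_lettersUB`, then `b8LeafOfRecordSubBH_cutSubB_of_knit_lettersRDUB_univ_t8H`.  Modulo `p6`, `p7`, `t8H` (displayed) and the sockets at the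
`Ω₀ = ℤᵈ` law members.  (p514768's `…_zdLan_…_t8H` RE-KEYED as above.)
[cite: Balaban1985RegularSpaces, Prop. 5 (1.106)–(1.109) p.94, Lemma 1 – Thm 8 pp.79–101; Balaban1985BackgroundPropagators, Thm 3.1 p.397] -/
theorem b8LeafOfRecordSubBH_cutSubB_zdLan_of_knit_lettersRDUB_univ_t8H {θ : Stage3Params} (lam : ResidB8 θ) (hD : 2 ≤ θ.D)
    (hB₁' : lam.B₁' = 5 * (θ.D : ℝ) * θ.L * lam.inp.B₀)
    {cB9 B₀'H B₂' BG BR cL : ℝ} (hB : 2 ≤ 5 * (θ.D : ℝ) * θ.L * lam.inp.B₀) (hB₀β : 0 < lam.B₀β) (hC₂ : 2097152 * ((θ.D : ℝ) + 1) ^ 2 ≤ lam.C₂)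
    (hcB9 : 0 < cB9) (hB₀'H : 0 < B₀'H) (hB₂' : 0 ≤ B₂') (hBG : 0 ≤ BG) (hBR : 0 ≤ BR) (hcL : 0 < cL)
    (hfree : 3 * (2 * (θ.D : ℝ) * (θ.L : ℝ) ^ 2) * BG * BR ≤ lam.inp.B₀')
    -- the two constant conditions of the Prop.-5 provider
    (hB₁2 : 2 ≤ lam.B₁) (hfree2 : 3 * (2 * (θ.D : ℝ) * (θ.L : ℝ) ^ 2) * BG * BR ≤ lam.inp.B₀' / 2)
    -- [4]'s letters and the b9 socket AT THE `Ω₀ = ℤᵈ` LAW MEMBERS ONLY (= the sub-index of record `IdxB8SubB θ`; the cube members are EXCLUDED): existence side (laws on print's domains) and uniqueness side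
    (SLet : ∀ i : ZdIdx θ.D θ.L, i.Ω 0 = Set.univ → IdxB8LawsB θ.L i → SockLettersRD (𝔸 := θ.𝔸) θ.L BG BR B₀'H B₂' cL i.η i.k i.Ω i.Λs)
    (SLetUB : ∀ i : ZdIdx θ.D θ.L, i.Ω 0 = Set.univ → IdxB8LawsB θ.L i → ∀ α₀ : ℝ, 0 < α₀ → α₀ ≤ cL → ∀ U₀ : Site θ.D → Fin θ.D → θ.𝔸ˣ, (∀ x κ, U₀ x κ ∈ unitaryUnits θ.𝔸) →
      InAk θ.L i.k i.η α₀ i.Ω U₀ →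
      ∃ (g Δ : (Site θ.D → θ.𝔸) →ₗ[ℂ] (Site θ.D → θ.𝔸)) (q : (Site θ.D → θ.𝔸) →ₗ[ℂ] (ℕ → Site θ.D → θ.𝔸))
        (qs : (ℕ → Site θ.D → θ.𝔸) →ₗ[ℂ] (Site θ.D → θ.𝔸)) (Aw c : (ℕ → Site θ.D → θ.𝔸) →ₗ[ℂ] (ℕ → Site θ.D → θ.𝔸))
        (H' : XSpace θ.D i.k θ.𝔸 →ₗ[ℂ] (Site θ.D → θ.𝔸)),
        (∀ x : Site θ.D → θ.𝔸, (∃ C : ℝ, ∀ y, ‖x y‖ ≤ C) → g (Δ x + qs (Aw (q x))) = x) ∧ (∀ φ, qs (c (q (g (g (qs φ))))) = qs φ) ∧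
        (∀ (f : Site θ.D → θ.𝔸), ∀ x ∈ i.Ω 0, Δ f x = covLap i.η U₀ ((i.Ω 0).indicator f) x) ∧
        (∀ (μ : ℕ → Site θ.D → θ.𝔸), ∀ x ∈ i.Ω 0, qs μ x = QT θ.L i.k (i.Λs i.k) U₀ μ x) ∧
        (∀ (f : Site θ.D → θ.𝔸) (n : ℕ), n ≤ i.k → ∀ y ∈ i.Λs i.k n, q f n y = QprimeIter (zdBlocking θ.D θ.L) (bgT θ.L U₀) n f y) ∧
        (∀ (f : Site θ.D → θ.𝔸) (n : ℕ) (y : Site θ.D), ¬ (n ≤ i.k ∧ y ∈ i.Λs i.k n) → q f n y = 0) ∧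
        (∀ (X : XSpace θ.D i.k θ.𝔸) (x : Site θ.D), ‖H' X x‖ ≤ B₀'H * ‖X‖) ∧
        (∀ n, n ≤ i.k → ∀ (X : XSpace θ.D i.k θ.𝔸), ∀ p ∈ {b : Site θ.D × Fin θ.D | SideTouches (i.Ω n) b.1 b.2},
          wt θ.L i.η n * ‖covDerivFwd i.η U₀ p.2 (H' X) p.1‖ ≤ B₀'H * ‖X‖) ∧
        (∀ X : XSpace θ.D i.k θ.𝔸, Bd2 θ.L i.η i.k i.Ω (covLap i.η U₀ (H' X)) (B₂' * ‖X‖)) ∧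
        (∀ (Y : XSpace θ.D i.k θ.𝔸) (n : ℕ) (hn : n ≤ i.k) (y : Site θ.D), y ∈ i.Λs i.k n →
          QprimeIter (zdBlocking θ.D θ.L) (bgT θ.L U₀) n (H' Y) y = Y (⟨n, Nat.lt_succ_of_le hn⟩, y)) ∧
        (∀ (f : Site θ.D → θ.𝔸) (r : ℝ), 0 ≤ r → Bd2 θ.L i.η i.k i.Ω f r →
          (∀ x, ‖g f x‖ ≤ BG * r) ∧ ∀ n, n ≤ i.k → ∀ p ∈ {b : Site θ.D × Fin θ.D | SideTouches (i.Ω n) b.1 b.2},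
            wt θ.L i.η n * ‖covDerivFwd i.η U₀ p.2 (g f) p.1‖ ≤ BG * r) ∧
        (∀ (f : Site θ.D → θ.𝔸) (r : ℝ), 0 ≤ r → Bd2 θ.L i.η i.k i.Ω f r → Bd2 θ.L i.η i.k i.Ω (f - g (qs (c (q (g f))))) (BR * r)))
    (SB9all : ∀ i : ZdIdx θ.D θ.L, i.Ω 0 = Set.univ → IdxB8LawsB θ.L i → ∀ m, m ≤ i.k →
      SockB9P3 (𝔸 := θ.𝔸) θ.L lam.inp.B₀ lam.B₀β cB9 lam.β lam.len i.η m i.Ω i.Λs i.Λb)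
    -- PROPOSITION 5's INDEX READ AS OBJECTS: `zdLan` members obeying the member laws, with [4]'s letters at each (RD currency)
    {J : Type} (ι : J → ZdLanIdx θ.D θ.𝔸)
    (hΩ0L : ∀ a : J, (ι a).Ω 0 = Set.univ) (hΩL : ∀ a : J, ∀ j, (ι a).Ω (j + 1) ⊆ (ι a).Ω j)
    (htowerL : ∀ a : J, ∀ j, j ≤ (ι a).k → ∀ y ∈ (ι a).Λ j, ∀ x, InBox (tlo θ.L y j) (thi θ.L y j) x → x ∈ (ι a).Ω j)
    (SLetL : ∀ a : J, ∀ α₀ : ℝ, 0 < α₀ → α₀ ≤ cL → InAk θ.L (ι a).k (ι a).η α₀ (ι a).Ω (ι a).U₀ →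
      ∃ (g Δ : (Site θ.D → θ.𝔸) →ₗ[ℂ] (Site θ.D → θ.𝔸)) (q : (Site θ.D → θ.𝔸) →ₗ[ℂ] (ℕ → Site θ.D → θ.𝔸))
        (qs : (ℕ → Site θ.D → θ.𝔸) →ₗ[ℂ] (Site θ.D → θ.𝔸)) (Aw c : (ℕ → Site θ.D → θ.𝔸) →ₗ[ℂ] (ℕ → Site θ.D → θ.𝔸))
        (H' : XSpace θ.D (ι a).k θ.𝔸 →ₗ[ℂ] (Site θ.D → θ.𝔸)),
        (∀ x, ∀ y ∈ (ι a).Ω 0, (Δ (g x) + qs (Aw (q (g x)))) y = x y) ∧ (∀ f, q (g (g (qs (c (q f))))) = q f) ∧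
        (∀ (f : Site θ.D → θ.𝔸), ∀ x ∈ (ι a).Ω 0, Δ f x = covLap (ι a).η (ι a).U₀ (((ι a).Ω 0).indicator f) x) ∧
        (∀ (μ : ℕ → Site θ.D → θ.𝔸), ∀ x ∈ (ι a).Ω 0, qs μ x = QT θ.L (ι a).k (ι a).Λ (ι a).U₀ μ x) ∧
        (∀ (f : Site θ.D → θ.𝔸) (j : ℕ), j ≤ (ι a).k → ∀ y ∈ (ι a).Λ j, q f j y = QprimeIter (zdBlocking θ.D θ.L) (bgT θ.L (ι a).U₀) j f y) ∧
        (∀ (X : XSpace θ.D (ι a).k θ.𝔸) (x : Site θ.D), ‖H' X x‖ ≤ B₀'H * ‖X‖) ∧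
        (∀ j, j ≤ (ι a).k → ∀ (X : XSpace θ.D (ι a).k θ.𝔸), ∀ p ∈ {b : Site θ.D × Fin θ.D | SideTouches ((ι a).Ω j) b.1 b.2},
          wt θ.L (ι a).η j * ‖covDerivFwd (ι a).η (ι a).U₀ p.2 (H' X) p.1‖ ≤ B₀'H * ‖X‖) ∧
        (∀ X : XSpace θ.D (ι a).k θ.𝔸, Bd2 θ.L (ι a).η (ι a).k (ι a).Ω (covLap (ι a).η (ι a).U₀ (H' X)) (B₂' * ‖X‖)) ∧
        (∀ (X : XSpace θ.D (ι a).k θ.𝔸) (x : Site θ.D), x ∉ (ι a).Ω 0 → H' X x = 0) ∧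
        (∀ X Y : XSpace θ.D (ι a).k θ.𝔸, (∀ p, Y p = -star (X p)) → ∀ x, H' Y x = -star (H' X x)) ∧
        (∀ (Y : XSpace θ.D (ι a).k θ.𝔸) (j : ℕ) (hj : j ≤ (ι a).k) (y : Site θ.D), y ∈ (ι a).Λ j →
          QprimeIter (zdBlocking θ.D θ.L) (bgT θ.L (ι a).U₀) j (H' Y) y = Y (⟨j, Nat.lt_succ_of_le hj⟩, y)) ∧
        (∀ (f : Site θ.D → θ.𝔸) (r : ℝ), 0 ≤ r → Bd2 θ.L (ι a).η (ι a).k (ι a).Ω f r →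
          (∀ x, ‖g f x‖ ≤ BG * r) ∧ ∀ j, j ≤ (ι a).k → ∀ p ∈ {b : Site θ.D × Fin θ.D | SideTouches ((ι a).Ω j) b.1 b.2},
            wt θ.L (ι a).η j * ‖covDerivFwd (ι a).η (ι a).U₀ p.2 (g f) p.1‖ ≤ BG * r) ∧
        (∀ (f : Site θ.D → θ.𝔸) (x : Site θ.D), x ∉ (ι a).Ω 0 → g f x = 0) ∧
        (∀ f : Site θ.D → θ.𝔸, (∀ j, j ≤ (ι a).k → ∀ x ∈ (ι a).Ω j, IsSelfAdjoint (f x)) → ∀ x, IsSelfAdjoint (g f x)) ∧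
        (∀ (f : Site θ.D → θ.𝔸) (r : ℝ), 0 ≤ r → Bd2 θ.L (ι a).η (ι a).k (ι a).Ω f r →
          Bd2 θ.L (ι a).η (ι a).k (ι a).Ω (f - g (qs (c (q (g f))))) (BR * r)) ∧
        (∀ f : Site θ.D → θ.𝔸, (∀ j, j ≤ (ι a).k → ∀ x ∈ (ι a).Ω j, IsSelfAdjoint (f x)) →
          ∀ j, j ≤ (ι a).k → ∀ x ∈ (ι a).Ω j, IsSelfAdjoint ((f - g (qs (c (q (g f))))) x)))
    -- [4]'s UNIQUENESS letters at the Prop-5 members (left-inverse law of G′ on bounded functions), for Prop. 5's uniqueness clause there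
    (SLetLU : ∀ a : J, ∀ α₀ : ℝ, 0 < α₀ → α₀ ≤ cL → InAk θ.L (ι a).k (ι a).η α₀ (ι a).Ω (ι a).U₀ →
      ∃ (g Δ : (Site θ.D → θ.𝔸) →ₗ[ℂ] (Site θ.D → θ.𝔸)) (q : (Site θ.D → θ.𝔸) →ₗ[ℂ] (ℕ → Site θ.D → θ.𝔸)) (qs : (ℕ → Site θ.D → θ.𝔸) →ₗ[ℂ] (Site θ.D → θ.𝔸))
        (Aw c : (ℕ → Site θ.D → θ.𝔸) →ₗ[ℂ] (ℕ → Site θ.D → θ.𝔸)) (H' : XSpace θ.D (ι a).k θ.𝔸 →ₗ[ℂ] (Site θ.D → θ.𝔸)),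
        (∀ x : Site θ.D → θ.𝔸, (∃ C : ℝ, ∀ y, ‖x y‖ ≤ C) → g (Δ x + qs (Aw (q x))) = x) ∧ (∀ φ, qs (c (q (g (g (qs φ))))) = qs φ) ∧
        (∀ (f : Site θ.D → θ.𝔸), ∀ x ∈ (ι a).Ω 0, Δ f x = covLap (ι a).η (ι a).U₀ (((ι a).Ω 0).indicator f) x) ∧
        (∀ (μ : ℕ → Site θ.D → θ.𝔸), ∀ x ∈ (ι a).Ω 0, qs μ x = QT θ.L (ι a).k (ι a).Λ (ι a).U₀ μ x) ∧
        (∀ (f : Site θ.D → θ.𝔸) (n : ℕ), n ≤ (ι a).k → ∀ y ∈ (ι a).Λ n, q f n y = QprimeIter (zdBlocking θ.D θ.L) (bgT θ.L (ι a).U₀) n f y) ∧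
        (∀ (f : Site θ.D → θ.𝔸) (n : ℕ) (y : Site θ.D), ¬ (n ≤ (ι a).k ∧ y ∈ (ι a).Λ n) → q f n y = 0) ∧
        (∀ (X : XSpace θ.D (ι a).k θ.𝔸) (x : Site θ.D), ‖H' X x‖ ≤ B₀'H * ‖X‖) ∧
        (∀ n, n ≤ (ι a).k → ∀ (X : XSpace θ.D (ι a).k θ.𝔸), ∀ p ∈ {b : Site θ.D × Fin θ.D | SideTouches ((ι a).Ω n) b.1 b.2},
          wt θ.L (ι a).η n * ‖covDerivFwd (ι a).η (ι a).U₀ p.2 (H' X) p.1‖ ≤ B₀'H * ‖X‖) ∧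
        (∀ X : XSpace θ.D (ι a).k θ.𝔸, Bd2 θ.L (ι a).η (ι a).k (ι a).Ω (covLap (ι a).η (ι a).U₀ (H' X)) (B₂' * ‖X‖)) ∧
        (∀ (Y : XSpace θ.D (ι a).k θ.𝔸) (n : ℕ) (hn : n ≤ (ι a).k) (y : Site θ.D), y ∈ (ι a).Λ n →
          QprimeIter (zdBlocking θ.D θ.L) (bgT θ.L (ι a).U₀) n (H' Y) y = Y (⟨n, Nat.lt_succ_of_le hn⟩, y)) ∧
        (∀ (f : Site θ.D → θ.𝔸) (r : ℝ), 0 ≤ r → Bd2 θ.L (ι a).η (ι a).k (ι a).Ω f r →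
          (∀ x, ‖g f x‖ ≤ BG * r) ∧ ∀ n, n ≤ (ι a).k → ∀ p ∈ {b : Site θ.D × Fin θ.D | SideTouches ((ι a).Ω n) b.1 b.2},
            wt θ.L (ι a).η n * ‖covDerivFwd (ι a).η (ι a).U₀ p.2 (g f) p.1‖ ≤ BG * r) ∧
        (∀ (f : Site θ.D → θ.𝔸) (r : ℝ), 0 ≤ r → Bd2 θ.L (ι a).η (ι a).k (ι a).Ω f r →
          Bd2 θ.L (ι a).η (ι a).k (ι a).Ω (f - g (qs (c (q (g f))))) (BR * r)))
    -- PROPOSITION 6 (displayed), PROPOSITION 7 and THEOREM 8 SURVIVING AT THE REPAIRED MEMBERS (hypotheses)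
    -- PROPOSITION 6 on the record's cube family at the cut constant `c₁` (DISPLAYED: its cube-socket road `SLetC`∕`SB9C` is certified unsatisfiable, p508450)
    (c₁ : ℝ) (p6 : B8.Prop6Printed θ.D (θ.L : ℝ) lam.B₁ c₁ (fun j : IdxB8SubB θ => cubB8OfRecord θ j.1))
    (p7 : B8SectGH.Prop7PrintedR (fun j : IdxB8SubB θ => famB8OfRecordSubB θ lam.β lam.len j) (fun j => lam.toAxial j.1))
    (t8H : B8Thm8Surviving.Thm8SurvivingAt 1 lam.B₁ lam.B₂ (fun j : IdxB8SubB θ => famB8OfRecordSubBH θ lam.β lam.len j)) :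
    B8LeafOfRecordSubBH θ (lam.cutSubB J (fun a : J => zdLan θ.L lam.B₁ (ι a)) c₁) := by
  -- Proposition 5's existence clause at the `zdLan` family, from [4]'s letters there (this seat's g3 provider)
  have p5e : B8.Prop5Exists lam.inp.B₀' lam.B₁ (fun a : J => zdLan θ.L lam.B₁ (ι a)) :=
    prop5Exists_zdLan_of_lettersRD hD θ.two_le_L hB₁2 lam.inp.B₀'_pos hB₀'H hB₂' hBG hBR hcL hfree2 ι hΩL htowerL SLetL
  -- Proposition 5's uniqueness clause at the `zdLan` family, from [4]'s guarded uniqueness letters there (this seat's g3 provider)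
  have p5u : B8.Prop5Unique (fun a : J => zdLan θ.L lam.B₁ (ι a)) :=
    prop5Unique_zdLan_of_lettersUB hD θ.two_le_L (le_trans (by norm_num) hB₁2) hB₀'H hB₂' hBG hBR hcL ι hΩ0L hΩL htowerL SLetLU
  exact b8LeafOfRecordSubBH_cutSubB_of_knit_lettersRDUB_univ_t8H lam hD hB₁' hB hB₀β hC₂ hcB9 hB₀'H hB₂' hBG hBR hcL hfree SLet SLetUB
    SB9all p5e p5u c₁ p6 p7 t8H

end KnitUniv

#print axioms b8LeafOfRecordSubBH_cutSubB_of_knit_lettersRDUB_univ_t8H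
#print axioms b8LeafOfRecordSubBH_cutSubB_zdLan_of_knit_lettersRDUB_univ_t8H

end Summit.QuantumFields.YangMills.BalabanUVNodes.N05SubBHKnitUniv

end
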